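import Mathlib
import Summits.Ventures.LatticeQCDFlow.TrivializingMaps.HaarIntegrationByParts
import Summits.Ventures.LatticeQCDFlow.TrivializingMaps.JacobianTransport

/-!
# LatticeQCDFlow / TrivializingMaps — the Jacobian formula: continuity of its ingredients and reduction to
# ambient `C¹` observables

HONEST FRAMING: exact (Metropolis-corrected) sampling algorithms for lattice gauge theory; figures
of merit are autocorrelation/cost numbers at stated couplings and volumes; no continuum-physics claim.

Venture `LatticeQCDFlow` (cell pub-lqcd), topic `TrivializingMaps`, row 31 (lean-2).  Shared final step of
the proof of Lüscher's Jacobian formula (3.9) (`JacobianFormula.lean`):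

* `continuous_linkDeriv_param`, `continuous_linkDiv_param` — `(τ, W) ↦ ∂_{e,X} F_τ(W)` and
  `(τ, W) ↦ div Z_τ(W)` are continuous for jointly `C¹` data;
* `continuous_of_isFlowMap` — a flow map `Φ_t` of a `C¹` tangent generator is continuous in the initial
  field (it is the cut-off ambient flow `cutFlow` read on `SU(n)^E`); `continuous_jacobianWeight` — the
  weight `V ↦ exp ∫₀ᵗ div Z_s(Φ_s V) ds` is continuous;
* `exists_contDiff_one_approx` — ambient `C¹` observables `Õ ∘ coe` are uniformly dense in
  `C(SU(n)^E, ℝ)` (Stone–Weierstrass: real and imaginary parts of matrix entries separate points);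
* `jacobian_formula_of_forall_contDiff` — if (3.9) holds at time `t` for every ambient `C¹` observable then
  it holds for every continuous observable (both sides are sup-norm continuous in the observable).

All elementary ([folklore]).
-/

noncomputable section

open MeasureTheory Matrix Set Filter Function Metric intervalIntegral
open scoped Matrix Topology NNReal

namespace Summit.Ventures.LatticeQCDFlow.TrivializingMaps

open Literature.MathematicalPhysics.QuantumFieldTheory
open Literature.MathematicalPhysics.QuantumFieldTheory.Luscher2010
open Literature.MathematicalPhysics.QuantumFieldTheory.WilsonFlow
open Literature.Analysis.ODE
open scoped Matrix.Norms.Frobenius ContDiff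

variable {d L n : ℕ} [NeZero L]

/-! ## §1. Continuity of link derivatives and of the divergence -/

section Divergence

/-- `∂_{e,X}` of a jointly `C¹` family is jointly continuous in `(τ, W)`. [folklore] -/
theorem continuous_linkDeriv_param {F : ℝ → AmbConfig d L n → ℝ}
    (hF : ContDiff ℝ 1 fun p : ℝ × AmbConfig d L n => F p.1 p.2) (e : Edge d L)
    (X : Matrix (Fin n) (Fin n) ℂ) :
    Continuous fun p : ℝ × AmbConfig d L n => linkDeriv e X (F p.1) p.2 := by
  have h01 : (0 : WithTop ℕ∞) + 1 ≤ 1 := by norm_num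
  have hsl : ∀ t, ContDiff ℝ 1 (F t) := fun t => hF.comp (contDiff_const.prodMk contDiff_id)
  have heq : (fun p : ℝ × AmbConfig d L n => linkDeriv e X (F p.1) p.2) =
      fun p => fderiv ℝ (F p.1) p.2 (Pi.single e (X * p.2 e)) :=
    funext fun p => linkDeriv_eq_fderiv ((hsl p.1).differentiable one_ne_zero p.2) e X
  rw [heq]
  have hunc : ContDiff ℝ 1
      (Function.uncurry fun (p : ℝ × AmbConfig d L n) (W : AmbConfig d L n) => F p.1 W) :=
    hF.comp ((contDiff_fst.comp contDiff_fst).prodMk contDiff_snd)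
  have hv : ContDiff ℝ 0 fun p : ℝ × AmbConfig d L n => (Pi.single e (X * p.2 e) : AmbConfig d L n) :=
    ((contDiff_pi_single_mul_apply (d := d) (L := L) (n := n) e X).of_le
      (by exact_mod_cast le_top)).comp contDiff_snd
  exact (hunc.fderiv_apply contDiff_snd hv h01).continuous

/-- **The divergence of a `C¹` generator is jointly continuous in `(τ, W)`.** [folklore] -/
theorem continuous_linkDiv_param (B : SuBasis n) {Z : Generator d L n}
    (hZ : ContDiff ℝ 1 fun p : ℝ × AmbConfig d L n => Z p.1 p.2) :
    Continuous fun p : ℝ × AmbConfig d L n => linkDiv B (Z p.1) p.2 := by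
  unfold linkDiv
  refine continuous_finsetSum _ fun e _ => continuous_finsetSum _ fun a _ => ?_
  exact continuous_linkDeriv_param (F := fun τ W => B.coord a (Z τ W e))
    ((suBasis_contDiff_coord B a).comp ((contDiff_apply ℝ _ e).comp hZ)) e (B.T a)

end Divergence

/-! ## §2. Continuity of the flow map and of the weight -/

section FlowContinuity

variable (B : SuBasis n) {Z : Generator d L n}
  {Φ : ℝ → GaugeConfig d L (Matrix.specialUnitaryGroup (Fin n) ℂ) →
    GaugeConfig d L (Matrix.specialUnitaryGroup (Fin n) ℂ)}

/-- **The flow map of a `C¹` tangent generator is continuous in the initial field** (read in the ambient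
space it is the jointly `C¹` cut-off flow). [cite: Luscher2010Trivializing, §3.1] -/
theorem continuous_of_isFlowMap (hZ1 : ContDiff ℝ 1 fun p : ℝ × AmbConfig d L n => Z p.1 p.2)
    (hΦ : IsFlowMap Z Φ) (t : ℝ) : Continuous (Φ t) := by
  set T : ℝ := |t| + 1 with hT
  have hT0 : 0 < T := by positivity
  have ht : t ∈ Ioo (-T) T := by constructor <;> cases abs_cases t <;> linarith
  have heq : ∀ V, coeConfig (Φ t V) = cutFlow hZ1 T 0 t (coeConfig V) :=
    fun V => (cutFlow_eq_coeConfig hZ1 T hΦ hT0 V ht).symm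
  have hc : Continuous fun V : GaugeConfig d L (Matrix.specialUnitaryGroup (Fin n) ℂ) =>
      cutFlow hZ1 T 0 t (coeConfig V) :=
    (contDiff_cutFlow hZ1 T).continuous.comp
      (continuous_const.prodMk (continuous_const.prodMk continuous_coeConfig))
  refine continuous_pi fun e => ?_
  rw [Topology.IsInducing.subtypeVal.continuous_iff]
  refine ((continuous_apply e).comp hc).congr fun V => ?_
  show cutFlow hZ1 T 0 t (coeConfig V) e =
    ((Φ t V e : Matrix.specialUnitaryGroup (Fin n) ℂ) : Matrix (Fin n) (Fin n) ℂ)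
  rw [← coeConfig_apply (Φ t V) e, heq V]

/-- **The weight `V ↦ exp ∫₀ᵗ div Z_s(Φ_s V) ds` of the Jacobian formula is continuous.** [folklore] -/
theorem continuous_jacobianWeight (hZ1 : ContDiff ℝ 1 fun p : ℝ × AmbConfig d L n => Z p.1 p.2)
    (hΦ : IsFlowMap Z Φ) (t : ℝ) :
    Continuous fun V : GaugeConfig d L (Matrix.specialUnitaryGroup (Fin n) ℂ) =>
      Real.exp (∫ s in (0 : ℝ)..t, linkDiv B (Z s) (coeConfig (Φ s V))) := by
  set T : ℝ := |t| + 1 with hT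
  have hT0 : 0 < T := by positivity
  have ht : t ∈ Ioo (-T) T := by constructor <;> cases abs_cases t <;> linarith
  have h0 : (0 : ℝ) ∈ Ioo (-T) T := ⟨by linarith, hT0⟩
  -- replace `Φ` by the cut-off flow inside the integral
  have heq : ∀ V, (∫ s in (0 : ℝ)..t, linkDiv B (Z s) (coeConfig (Φ s V))) =
      ∫ s in (0 : ℝ)..t, linkDiv B (Z s) (cutFlow hZ1 T 0 s (coeConfig V)) := by
    intro V
    refine intervalIntegral.integral_congr fun r hr => ?_
    have hr' : r ∈ Ioo (-T) T := by
      rcases mem_uIcc.1 hr with h | h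
      · exact ⟨lt_of_lt_of_le h0.1 h.1, lt_of_le_of_lt h.2 ht.2⟩
      · exact ⟨lt_of_lt_of_le ht.1 h.1, lt_of_le_of_lt h.2 h0.2⟩
    show linkDiv B (Z r) (coeConfig (Φ r V)) = linkDiv B (Z r) (cutFlow hZ1 T 0 r (coeConfig V))
    rw [cutFlow_eq_coeConfig hZ1 T hΦ hT0 V hr']
  have hΨ : Continuous fun q : GaugeConfig d L (Matrix.specialUnitaryGroup (Fin n) ℂ) × ℝ =>
      cutFlow hZ1 T 0 q.2 (coeConfig q.1) :=
    (contDiff_cutFlow hZ1 T).continuous.comp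
      (continuous_const.prodMk (continuous_snd.prodMk (continuous_coeConfig.comp continuous_fst)))
  have hjoint : Continuous (Function.uncurry fun (V : GaugeConfig d L (Matrix.specialUnitaryGroup (Fin n) ℂ))
      (s : ℝ) => linkDiv B (Z s) (cutFlow hZ1 T 0 s (coeConfig V))) :=
    (continuous_linkDiv_param B hZ1).comp₂ continuous_snd hΨ
  have hint := intervalIntegral.continuous_parametric_intervalIntegral_of_continuous'
    (μ := MeasureTheory.volume) hjoint 0 t
  refine (Real.continuous_exp.comp hint).congr fun V => ?_
  show Real.exp (∫ s in (0 : ℝ)..t, linkDiv B (Z s) (cutFlow hZ1 T 0 s (coeConfig V))) = _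
  rw [← heq V]

end FlowContinuity

/-! ## §3. Density of ambient `C¹` observables -/

section Density

/-- **Ambient `C¹` observables are uniformly dense in `C(SU(n)^E, ℝ)`** (Stone–Weierstrass: the real and
imaginary parts of the matrix entries are restrictions of real-linear functionals and separate points).
[folklore] -/
theorem exists_contDiff_one_approx (O : GaugeConfig d L (Matrix.specialUnitaryGroup (Fin n) ℂ) → ℝ)
    (hO : Continuous O) {ε : ℝ} (hε : 0 < ε) :
    ∃ Õ : AmbConfig d L n → ℝ, ContDiff ℝ 1 Õ ∧ ∀ V, |O V - Õ (coeConfig V)| < ε := by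
  -- the subalgebra of restrictions of ambient `C¹` functions
  let A : Subalgebra ℝ C(GaugeConfig d L (Matrix.specialUnitaryGroup (Fin n) ℂ), ℝ) :=
    { carrier := {f | ∃ Õ : AmbConfig d L n → ℝ, ContDiff ℝ 1 Õ ∧ ∀ V, f V = Õ (coeConfig V)}
      mul_mem' := by
        rintro f g ⟨Of, hOf, hf⟩ ⟨Og, hOg, hg⟩
        exact ⟨fun W => Of W * Og W, hOf.mul hOg, fun V => by simp [hf V, hg V]⟩
      one_mem' := ⟨fun _ => 1, contDiff_const, fun V => by simp⟩
      add_mem' := by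
        rintro f g ⟨Of, hOf, hf⟩ ⟨Og, hOg, hg⟩
        exact ⟨fun W => Of W + Og W, hOf.add hOg, fun V => by simp [hf V, hg V]⟩
      zero_mem' := ⟨fun _ => 0, contDiff_const, fun V => by simp⟩
      algebraMap_mem' := fun r => ⟨fun _ => r, contDiff_const, fun V => by simp⟩ }
  -- it separates points: two distinct configurations differ in the real or imaginary part of some entry
  have hA : A.SeparatesPoints := by
    intro V V' hVV'
    have : ∃ e i j, (coeConfig V e i j : ℂ) ≠ coeConfig V' e i j := by
      by_contra h
      push Not at h
      exact hVV' (coeConfig_injective (funext fun e => Matrix.ext fun i j => h e i j))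
    obtain ⟨e, i, j, hne⟩ := this
    have hlin : ∀ (φ : ℂ →L[ℝ] ℝ), ContDiff ℝ 1 (fun W : AmbConfig d L n => φ (W e i j)) := fun φ =>
      φ.contDiff.comp ((entryCLM i j).contDiff.comp (contDiff_apply ℝ _ e))
    rcases Complex.ext_iff.not.1 hne |> not_and_or.1 with hre | him
    · refine ⟨_, ⟨⟨fun V => (coeConfig V e i j).re, ?_⟩, ⟨fun W => (W e i j).re, hlin Complex.reCLM,
        fun V => rfl⟩, rfl⟩, hre⟩
      exact Complex.continuous_re.comp ((continuous_apply j).comp ((continuous_apply i).comp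
        ((continuous_apply e).comp continuous_coeConfig)))
    · refine ⟨_, ⟨⟨fun V => (coeConfig V e i j).im, ?_⟩, ⟨fun W => (W e i j).im, hlin Complex.imCLM,
        fun V => rfl⟩, rfl⟩, him⟩
      exact Complex.continuous_im.comp ((continuous_apply j).comp ((continuous_apply i).comp
        ((continuous_apply e).comp continuous_coeConfig)))
  have hdense := ContinuousMap.subalgebra_topologicalClosure_eq_top_of_separatesPoints A hA
  have hmem : (⟨O, hO⟩ : C(GaugeConfig d L (Matrix.specialUnitaryGroup (Fin n) ℂ), ℝ)) ∈
      A.topologicalClosure := by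
    rw [hdense]; trivial
  have hmem' : (⟨O, hO⟩ : C(GaugeConfig d L (Matrix.specialUnitaryGroup (Fin n) ℂ), ℝ)) ∈
      closure (A : Set C(GaugeConfig d L (Matrix.specialUnitaryGroup (Fin n) ℂ), ℝ)) := by
    rw [← Subalgebra.topologicalClosure_coe, SetLike.mem_coe]; exact hmem
  obtain ⟨f, hfA, hdist⟩ := Metric.mem_closure_iff.1 hmem' ε hε
  obtain ⟨Õ, hÕ, hf⟩ := hfA
  refine ⟨Õ, hÕ, fun V => ?_⟩
  have h1 := ContinuousMap.dist_apply_le_dist (f := (⟨O, hO⟩ : C(_, ℝ))) (g := f) V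
  rw [← hf V, ← Real.dist_eq]
  exact lt_of_le_of_lt h1 hdist

end Density

/-! ## §4. Reduction of the Jacobian formula to ambient `C¹` observables -/

section Reduction

/-- **If the Jacobian formula (3.9) holds at time `t` for every ambient `C¹` observable `Õ ∘ coe`, it holds
for every continuous observable** (density + both sides are sup-norm continuous in the observable, the
weight being continuous). [cite: Luscher2010Trivializing, §3.2 eq. (3.9)] -/
theorem jacobian_formula_of_forall_contDiff (B : SuBasis n) {Z : Generator d L n}
    (hZ1 : ContDiff ℝ 1 fun p : ℝ × AmbConfig d L n => Z p.1 p.2)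
    {Φ : ℝ → GaugeConfig d L (Matrix.specialUnitaryGroup (Fin n) ℂ) →
      GaugeConfig d L (Matrix.specialUnitaryGroup (Fin n) ℂ)} (hΦ : IsFlowMap Z Φ) (t : ℝ)
    (H : ∀ Õ : AmbConfig d L n → ℝ, ContDiff ℝ 1 Õ →
      ∫ U, Õ (coeConfig U) ∂(trivialMeasure (Matrix.specialUnitaryGroup (Fin n) ℂ) d L) =
        ∫ V, Õ (coeConfig (Φ t V)) *
            Real.exp (∫ s in (0 : ℝ)..t, linkDiv B (Z s) (coeConfig (Φ s V)))
          ∂(trivialMeasure (Matrix.specialUnitaryGroup (Fin n) ℂ) d L))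
    (O : GaugeConfig d L (Matrix.specialUnitaryGroup (Fin n) ℂ) → ℝ) (hO : Continuous O) :
    ∫ U, O U ∂(trivialMeasure (Matrix.specialUnitaryGroup (Fin n) ℂ) d L) =
      ∫ V, O (Φ t V) * Real.exp (∫ s in (0 : ℝ)..t, linkDiv B (Z s) (coeConfig (Φ s V)))
        ∂(trivialMeasure (Matrix.specialUnitaryGroup (Fin n) ℂ) d L) := by
  haveI : SecondCountableTopology (Matrix (Fin n) (Fin n) ℂ) :=
    inferInstanceAs (SecondCountableTopology (Fin n → Fin n → ℂ))
  haveI : SecondCountableTopology (Matrix.specialUnitaryGroup (Fin n) ℂ) :=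
    Topology.IsEmbedding.subtypeVal.secondCountableTopology
  haveI : IsProbabilityMeasure (trivialMeasure (Matrix.specialUnitaryGroup (Fin n) ℂ) d L) := by
    unfold trivialMeasure; infer_instance
  set μ := trivialMeasure (Matrix.specialUnitaryGroup (Fin n) ℂ) d L with hμ
  set w : GaugeConfig d L (Matrix.specialUnitaryGroup (Fin n) ℂ) → ℝ :=
    fun V => Real.exp (∫ s in (0 : ℝ)..t, linkDiv B (Z s) (coeConfig (Φ s V))) with hw
  have hwc : Continuous w := continuous_jacobianWeight B hZ1 hΦ t
  have hw0 : ∀ V, 0 ≤ w V := fun V => (Real.exp_pos _).le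
  have hΦc : Continuous (Φ t) := continuous_of_isFlowMap hZ1 hΦ t
  have hint : ∀ {φ : GaugeConfig d L (Matrix.specialUnitaryGroup (Fin n) ℂ) → ℝ},
      Continuous φ → Integrable φ μ := fun hφ =>
    (BoundedContinuousFunction.mkOfCompact ⟨_, hφ⟩).integrable _
  -- both sides are `ε`-close for every `ε > 0`
  have hclose : ∀ ε > 0, |(∫ U, O U ∂μ) - ∫ V, O (Φ t V) * w V ∂μ| ≤ ε * (1 + ∫ V, w V ∂μ) := by
    intro ε hε
    obtain ⟨Õ, hÕ, happ⟩ := exists_contDiff_one_approx O hO hε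
    have hsm := H Õ hÕ
    have hÕc : Continuous fun V : GaugeConfig d L (Matrix.specialUnitaryGroup (Fin n) ℂ) => Õ (coeConfig V) :=
      hÕ.continuous.comp continuous_coeConfig
    -- first difference: `|∫ O - ∫ Õ∘coe| ≤ ε`
    have h1 : |(∫ U, O U ∂μ) - ∫ U, Õ (coeConfig U) ∂μ| ≤ ε * 1 := by
      rw [← integral_sub (hint hO) (hint hÕc)]
      have := norm_integral_le_of_norm_le_const (μ := μ) (f := fun U => O U - Õ (coeConfig U)) (C := ε)
        (ae_of_all _ fun U => (happ U).le)
      rwa [Real.norm_eq_abs, probReal_univ] at this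
    -- second difference: `|∫ (Õ∘coe∘Φ_t) w - ∫ (O∘Φ_t) w| ≤ ε ∫ w`
    have i1 : Integrable (fun V => Õ (coeConfig (Φ t V)) * w V) μ := hint ((hÕc.comp hΦc).mul hwc)
    have i2 : Integrable (fun V => O (Φ t V) * w V) μ := hint ((hO.comp hΦc).mul hwc)
    have h2 : |(∫ V, Õ (coeConfig (Φ t V)) * w V ∂μ) - ∫ V, O (Φ t V) * w V ∂μ| ≤ ε * ∫ V, w V ∂μ := by
      rw [← integral_sub i1 i2, ← MeasureTheory.integral_const_mul]
      have := norm_integral_le_of_norm_le (μ := μ)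
        (f := fun V => Õ (coeConfig (Φ t V)) * w V - O (Φ t V) * w V) (g := fun V => ε * w V)
        ((hint hwc).const_mul ε) (ae_of_all _ fun V => ?_)
      · rwa [Real.norm_eq_abs] at this
      · rw [← sub_mul, norm_mul, Real.norm_eq_abs, Real.norm_eq_abs, abs_of_nonneg (hw0 V), abs_sub_comm]
        exact mul_le_mul_of_nonneg_right (happ (Φ t V)).le (hw0 V)
    rw [hsm] at h1
    calc |(∫ U, O U ∂μ) - ∫ V, O (Φ t V) * w V ∂μ|
        ≤ |(∫ U, O U ∂μ) - ∫ V, Õ (coeConfig (Φ t V)) * w V ∂μ| +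
          |(∫ V, Õ (coeConfig (Φ t V)) * w V ∂μ) - ∫ V, O (Φ t V) * w V ∂μ| := abs_sub_le _ _ _
      _ ≤ ε * 1 + ε * ∫ V, w V ∂μ := add_le_add h1 h2
      _ = ε * (1 + ∫ V, w V ∂μ) := by ring
  have hpos : 0 < 1 + ∫ V, w V ∂μ := by
    have : 0 ≤ ∫ V, w V ∂μ := integral_nonneg hw0
    linarith
  have habs : |(∫ U, O U ∂μ) - ∫ V, O (Φ t V) * w V ∂μ| ≤ 0 := by
    refine le_of_forall_pos_le_add fun ε hε => ?_
    have h := hclose (ε / (1 + ∫ V, w V ∂μ)) (div_pos hε hpos)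
    rw [div_mul_cancel₀ _ hpos.ne'] at h
    linarith
  exact sub_eq_zero.1 (abs_nonpos_iff.1 habs)

end Reduction

end Summit.Ventures.LatticeQCDFlow.TrivializingMaps

end
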